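import Mathlib.Analysis.SpecialFunctions.Pow.Real
import HarnessLib

/-!
# `V4` under parallel composition, ordered form: an `(H1)`-piece is absorbed by any `V4`-piece

Support file for crux `stmt-CriticalPhenomena-4575` (`NoHeavyLowerTail`), seat `prim-nh-lead-4575` lead gen 132 (`--supports stmt-CriticalPhenomena-4575`;
memo `run/shared/lean/prim/prim-nh-lead-4575/FROM-prim-nh-lead-4575-g132-H1-REFUTED.md`).  No definitions, no sorries, standard axioms.
Companion of `…SuperTerminalQuarticParallel` (lead gen 131, symmetric form: `V4 ∧ (H1)` for EVERY piece ⟹ `V4` for the composite).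

Setting (as there).  Two 4-terminal gadgets glued at `s, a, b, c`; cells of the 4-point partition law of a gadget: `n = P(s|a|b|c)`, `σ = P(sa|b|c)`,
`ζ = P(sa|cb)`, `β = P(cb|s|a)`, `ξs = P(sc|a|b)`, `ξa = P(ac|s|b)`, `τ = P(sac|b)`, `γ = P(c singleton)`.  By the join rule
(`Literature.Probability.Percolation.PartitionGluing.real_partLE`) the composite has
`Q = (n+σ)(n'+σ') − n n'`, `A = (n+σ+β+ζ)(n'+σ'+β'+ζ') − (n+β)(n'+β')`,
`B = (n+σ+ξs+ξa+τ)(n'+σ'+ξs'+ξa'+τ') − (n+ξs)(n'+ξs') − (n+ξa)(n'+ξa') + n n'`, `C = γγ'`.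

THE POINT (gen 132).  The row `(H1)` `n⁴ ≤ (n+β)²(n+ξs+ξa)²γ` is FALSE for general gadgets (it fails for the parallel power `khub3(k)`, `k ≥ 59`, of a
three-leg hub — memo §1), so the symmetric principle cannot reduce `V4` to prime graphs.  What survives is the ORDERED (telescoping) form, in which the
second piece needs, instead of `(H1)`, only the TROPICAL inequality
  `(T)`  `(n+σ)⁴ ≤ (n+σ+β+ζ)² (n+σ+ξs+ξa+τ)² γ`,
which is the three-point quartic isolation law `(Q4)_c` of the gadget with `s, a` glued — a THEOREM for every finite weighted graph
(`…ThreePointIsoSexticUniversal`, `(Q6) ⟹ (Q4)`), and which is multiplicative under gluing (`trop_mul`).  Hence (`quartic_ordered`):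
**`[V4 ∧ (H1)](piece 1) ∧ [V4 ∧ (T)](piece 2) ⟹ V4(composite)`**, and the composite again satisfies `(T)`; iterating, any number of
`(H1)`-pieces (stars: `…SuperTerminalQuarticStar.star_H1`; gadgets with ≤ 2 internal vertices: exact certificates) can be glued onto ONE arbitrary
`V4`-piece.  Proof: `Q = σ(n'+σ') + nσ'`, `A = (σ+ζ)(n'+σ'+β'+ζ') + (n+β)(σ'+ζ')`, `B ≥ (σ+τ)(n'+σ'+ξs'+ξa'+τ') + (n+ξs+ξa)(σ'+τ')`,
termwise `[σ(n'+σ')]⁴ ≤ [(σ+ζ) d₂']²[(σ+τ) d₄']² γγ'` (`V4 × (T)`) and `[nσ']⁴ ≤ [(n+β)(σ'+ζ')]²[(n+ξ)(σ'+τ')]²γγ'` (`(H1) × V4`), Cauchy–Schwarz.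
-/

namespace Summit.CriticalPhenomena.PercolationContinuityZ3.Theorems.SuperTerminalQuarticOrdered

open Real

/-- Two-term Cauchy–Schwarz in quartic form: `q₁⁴ ≤ a₁²b₁²C`, `q₂⁴ ≤ a₂²b₂²C` (all nonnegative) ⟹ `(q₁+q₂)⁴ ≤ (a₁+a₂)²(b₁+b₂)²C`. [folklore] -/
theorem add_pow_four_le {q₁ q₂ a₁ a₂ b₁ b₂ C : ℝ} (ha₁ : 0 ≤ a₁) (ha₂ : 0 ≤ a₂)
    (hb₁ : 0 ≤ b₁) (hb₂ : 0 ≤ b₂) (hC : 0 ≤ C)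
    (h₁ : q₁ ^ 4 ≤ a₁ ^ 2 * b₁ ^ 2 * C) (h₂ : q₂ ^ 4 ≤ a₂ ^ 2 * b₂ ^ 2 * C) :
    (q₁ + q₂) ^ 4 ≤ (a₁ + a₂) ^ 2 * (b₁ + b₂) ^ 2 * C := by
  set r := Real.sqrt C with hr
  have hr0 : 0 ≤ r := Real.sqrt_nonneg C
  have hr2 : r ^ 2 = C := by rw [hr, Real.sq_sqrt hC]
  -- square roots of the two hypotheses (cf. `SuperTerminalQuarticParallel.sq_le_of_pow_four_le`)
  have root : ∀ {q a b : ℝ}, 0 ≤ a → 0 ≤ b → q ^ 4 ≤ a ^ 2 * b ^ 2 * C → q ^ 2 ≤ a * (b * r) := by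
    intro q a b ha hb h
    have hR : 0 ≤ a * (b * r) := by positivity
    have h2 : (q ^ 2) ^ 2 ≤ (a * (b * r)) ^ 2 := by
      calc (q ^ 2) ^ 2 = q ^ 4 := by ring
        _ ≤ a ^ 2 * b ^ 2 * C := h
        _ = (a * (b * r)) ^ 2 := by rw [← hr2]; ring
    exact (pow_le_pow_iff_left₀ (by positivity) hR two_ne_zero).mp h2
  have k₁ : q₁ ^ 2 ≤ a₁ * (b₁ * r) := root ha₁ hb₁ h₁
  have k₂ : q₂ ^ 2 ≤ a₂ * (b₂ * r) := root ha₂ hb₂ h₂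
  -- `(q₁+q₂)² ≤ (a₁+a₂)(b₁+b₂) r`: from `2 q₁ q₂ ≤ a₁ b₂ r + a₂ b₁ r` (AM–GM on `k₁ k₂`)
  have hx : 0 ≤ a₁ * (b₂ * r) := by positivity
  have hy : 0 ≤ a₂ * (b₁ * r) := by positivity
  have cross : (q₁ * q₂) ^ 2 ≤ (a₁ * (b₂ * r)) * (a₂ * (b₁ * r)) := by
    calc (q₁ * q₂) ^ 2 = q₁ ^ 2 * q₂ ^ 2 := by ring
      _ ≤ (a₁ * (b₁ * r)) * (a₂ * (b₂ * r)) := mul_le_mul k₁ k₂ (sq_nonneg _) (by positivity)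
      _ = (a₁ * (b₂ * r)) * (a₂ * (b₁ * r)) := by ring
  have cross2 : 2 * (q₁ * q₂) ≤ a₁ * (b₂ * r) + a₂ * (b₁ * r) := by
    nlinarith [sq_nonneg (a₁ * (b₂ * r) - a₂ * (b₁ * r)), cross, hx, hy,
      sq_nonneg (2 * (q₁ * q₂) - (a₁ * (b₂ * r) + a₂ * (b₁ * r)))]
  have key : (q₁ + q₂) ^ 2 ≤ (a₁ + a₂) * ((b₁ + b₂) * r) := by nlinarith [k₁, k₂, cross2]
  have hR : 0 ≤ (a₁ + a₂) * ((b₁ + b₂) * r) := by positivity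
  have key2 : ((q₁ + q₂) ^ 2) ^ 2 ≤ ((a₁ + a₂) * ((b₁ + b₂) * r)) ^ 2 := pow_le_pow_left₀ (by positivity) key 2
  calc (q₁ + q₂) ^ 4 = ((q₁ + q₂) ^ 2) ^ 2 := by ring
    _ ≤ ((a₁ + a₂) * ((b₁ + b₂) * r)) ^ 2 := key2
    _ = (a₁ + a₂) ^ 2 * (b₁ + b₂) ^ 2 * r ^ 2 := by ring
    _ = (a₁ + a₂) ^ 2 * (b₁ + b₂) ^ 2 * C := by rw [hr2]

/-- Products of two quartic inequalities: `x⁴ ≤ a²b²c`, `y⁴ ≤ d²e²f` with `x, y ≥ 0` ⟹ `(xy)⁴ ≤ (ad)²(be)²(cf)`. [folklore] -/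
theorem mul_pow_four_le {x y a b c d e f : ℝ}
    (h₁ : x ^ 4 ≤ a ^ 2 * b ^ 2 * c) (h₂ : y ^ 4 ≤ d ^ 2 * e ^ 2 * f) :
    (x * y) ^ 4 ≤ (a * d) ^ 2 * (b * e) ^ 2 * (c * f) := by
  have hx4 : 0 ≤ x ^ 4 := by positivity
  have hy4 : 0 ≤ y ^ 4 := by positivity
  calc (x * y) ^ 4 = x ^ 4 * y ^ 4 := by ring
    _ ≤ (a ^ 2 * b ^ 2 * c) * (d ^ 2 * e ^ 2 * f) := mul_le_mul h₁ h₂ hy4 (le_trans hx4 h₁)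
    _ = (a * d) ^ 2 * (b * e) ^ 2 * (c * f) := by ring

/-- **`(T)` is multiplicative.**  If `d₁⁴ ≤ d₂²d₄²d₇` holds for two pieces (nonnegative down-set coordinates `d₁ = n+σ`, `d₂ = n+σ+β+ζ`,
`d₄ = n+σ+ξs+ξa+τ`, `d₇ = γ`, which multiply under gluing), it holds for the composite. [this work] -/
theorem trop_mul {d₁ d₂ d₄ d₇ e₁ e₂ e₄ e₇ : ℝ}
    (h₁ : d₁ ^ 4 ≤ d₂ ^ 2 * d₄ ^ 2 * d₇) (h₂ : e₁ ^ 4 ≤ e₂ ^ 2 * e₄ ^ 2 * e₇) :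
    (d₁ * e₁) ^ 4 ≤ (d₂ * e₂) ^ 2 * (d₄ * e₄) ^ 2 * (d₇ * e₇) :=
  mul_pow_four_le h₁ h₂

/-- **The ordered parallel-composition principle for `V4` (two pieces).**  Piece 1 (cells unprimed) satisfies `V4`: `σ⁴ ≤ (σ+ζ)²(σ+τ)²γ` and
the row `(H1)`: `n⁴ ≤ (n+β)²(n+ξs+ξa)²γ`; piece 2 (cells primed, written `n' σ' …`) satisfies `V4` and the tropical three-point inequality
`(T)`: `(n'+σ')⁴ ≤ (n'+σ'+β'+ζ')²(n'+σ'+ξs'+ξa'+τ')²γ'`.  Then the composite cells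
`Q = (n+σ)(n'+σ') − nn'`, `A = (n+σ+β+ζ)(n'+σ'+β'+ζ') − (n+β)(n'+β')`,
`B = (n+σ+ξs+ξa+τ)(n'+σ'+ξs'+ξa'+τ') − (n+ξs)(n'+ξs') − (n+ξa)(n'+ξa') + nn'`, `C = γγ'` satisfy `Q⁴ ≤ A²B²C`. [this work] -/
theorem quartic_ordered {n σ ζ β ξs ξa τ γ n' σ' ζ' β' ξs' ξa' τ' γ' : ℝ}
    (hn : 0 ≤ n) (hσ : 0 ≤ σ) (hζ : 0 ≤ ζ) (hβ : 0 ≤ β) (hξs : 0 ≤ ξs) (hξa : 0 ≤ ξa) (hτ : 0 ≤ τ) (hγ : 0 ≤ γ)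
    (hn' : 0 ≤ n') (hσ' : 0 ≤ σ') (hζ' : 0 ≤ ζ') (hβ' : 0 ≤ β') (hξs' : 0 ≤ ξs') (hξa' : 0 ≤ ξa') (hτ' : 0 ≤ τ') (hγ' : 0 ≤ γ')
    (hV : σ ^ 4 ≤ (σ + ζ) ^ 2 * (σ + τ) ^ 2 * γ)
    (hH : n ^ 4 ≤ (n + β) ^ 2 * (n + ξs + ξa) ^ 2 * γ)
    (hV' : σ' ^ 4 ≤ (σ' + ζ') ^ 2 * (σ' + τ') ^ 2 * γ')
    (hT' : (n' + σ') ^ 4 ≤ (n' + σ' + β' + ζ') ^ 2 * (n' + σ' + ξs' + ξa' + τ') ^ 2 * γ') :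
    ((n + σ) * (n' + σ') - n * n') ^ 4 ≤
      ((n + σ + β + ζ) * (n' + σ' + β' + ζ') - (n + β) * (n' + β')) ^ 2 *
        ((n + σ + ξs + ξa + τ) * (n' + σ' + ξs' + ξa' + τ') - (n + ξs) * (n' + ξs') - (n + ξa) * (n' + ξa') + n * n') ^ 2 *
          (γ * γ') := by
  -- telescoping decompositions (piece 1 first)
  have eQ : (n + σ) * (n' + σ') - n * n' = σ * (n' + σ') + n * σ' := by ring
  have eA : (n + σ + β + ζ) * (n' + σ' + β' + ζ') - (n + β) * (n' + β') =
      (σ + ζ) * (n' + σ' + β' + ζ') + (n + β) * (σ' + ζ') := by ring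
  have eB : (n + σ + ξs + ξa + τ) * (n' + σ' + ξs' + ξa' + τ') - (n + ξs) * (n' + ξs') - (n + ξa) * (n' + ξa') + n * n' =
      ((σ + τ) * (n' + σ' + ξs' + ξa' + τ') + (n + ξs + ξa) * (σ' + τ')) + (ξs * ξa' + ξa * ξs') := by ring
  have hB0nn : 0 ≤ (σ + τ) * (n' + σ' + ξs' + ξa' + τ') + (n + ξs + ξa) * (σ' + τ') := by positivity
  have hcross : 0 ≤ ξs * ξa' + ξa * ξs' := by positivity
  -- termwise
  have t1 : (σ * (n' + σ')) ^ 4 ≤ ((σ + ζ) * (n' + σ' + β' + ζ')) ^ 2 * ((σ + τ) * (n' + σ' + ξs' + ξa' + τ')) ^ 2 * (γ * γ') :=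
    mul_pow_four_le hV hT'
  have t2 : (n * σ') ^ 4 ≤ ((n + β) * (σ' + ζ')) ^ 2 * ((n + ξs + ξa) * (σ' + τ')) ^ 2 * (γ * γ') :=
    mul_pow_four_le hH hV'
  have main : (σ * (n' + σ') + n * σ') ^ 4 ≤
      ((σ + ζ) * (n' + σ' + β' + ζ') + (n + β) * (σ' + ζ')) ^ 2 *
        ((σ + τ) * (n' + σ' + ξs' + ξa' + τ') + (n + ξs + ξa) * (σ' + τ')) ^ 2 * (γ * γ') :=
    add_pow_four_le (by positivity) (by positivity) (by positivity) (by positivity) (by positivity) t1 t2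
  rw [eQ, eA, eB]
  have hsq : ((σ + τ) * (n' + σ' + ξs' + ξa' + τ') + (n + ξs + ξa) * (σ' + τ')) ^ 2 ≤
      (((σ + τ) * (n' + σ' + ξs' + ξa' + τ') + (n + ξs + ξa) * (σ' + τ')) + (ξs * ξa' + ξa * ξs')) ^ 2 :=
    pow_le_pow_left₀ hB0nn (le_add_of_nonneg_right hcross) 2
  have hA2 : 0 ≤ ((σ + ζ) * (n' + σ' + β' + ζ') + (n + β) * (σ' + ζ')) ^ 2 := sq_nonneg _
  have hC : 0 ≤ γ * γ' := by positivity
  calc (σ * (n' + σ') + n * σ') ^ 4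
      ≤ ((σ + ζ) * (n' + σ' + β' + ζ') + (n + β) * (σ' + ζ')) ^ 2 *
        ((σ + τ) * (n' + σ' + ξs' + ξa' + τ') + (n + ξs + ξa) * (σ' + τ')) ^ 2 * (γ * γ') := main
    _ ≤ ((σ + ζ) * (n' + σ' + β' + ζ') + (n + β) * (σ' + ζ')) ^ 2 *
        (((σ + τ) * (n' + σ' + ξs' + ξa' + τ') + (n + ξs + ξa) * (σ' + τ')) + (ξs * ξa' + ξa * ξs')) ^ 2 * (γ * γ') :=
        mul_le_mul_of_nonneg_right (mul_le_mul_of_nonneg_left hsq hA2) hC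

end Summit.CriticalPhenomena.PercolationContinuityZ3.Theorems.SuperTerminalQuarticOrdered
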